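import Summits.CriticalPhenomena.PercolationContinuityZ3.Theorems.PercNearOneGluingNoHeavyQuantFarBlockReach
import HarnessLib

/-!
# QUANT lane R8, front "FAR beyond trees", layer one — TWO-TERMINAL BLOCKS I: reachability around a vertex set hanging at TWO
# cut vertices

builds on p205010 (kernel theorem, internal audit signed; external expert review pending)

Support file (`--supports stmt-CriticalPhenomena-4575`), seat `prim-quant-p1` (gen 25); memo
`run/shared/lean/prim/quant/prim-quant-p1-g25/FOR-LEAD-TWOTERMINAL.md` §2 (the two-terminal programme of p1 g24's memo
`FOR-LEAD-INTRINSIC.md` §9).  Pure combinatorics of open paths (no measure); standard axioms; no sorries.  This is the two-terminal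
analogue of `…QuantFarBlockReach` (one cut vertex, `Block.Good`, `Block.reach_in_iff`).

**Setting.**  Vertices `Fin n`; a configuration `ω`; observer `o ∉ Z`; a BLOCK `Z` hanging at two terminals `c₁, c₂ ∉ Z`: the
configuration is GOOD if every open pair joining a vertex of `Z` to a vertex outside `Z` ends at `c₁` or `c₂`
(almost surely so when the weights vanish between `Z` and `(Z ∪ {c₁, c₂})ᶜ`, file II).  Write `x ~ y off Z` for reachability through
the open pairs AVOIDING `Z` (`Bundle.offZ`) and `x ~ y on Z` through the open pairs MEETING `Z` (`Block.onZ`).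

* no definitions: goodness and "terminal `c` LEADS to `a ∈ Z`" (some terminal `c'` with `c' ~ a on Z`, where `c' = c` or the two
  terminals are joined off `Z` or on `Z`) are written out in every statement;
* `Block.inv₂_of_walk` — the walk invariant: along an open walk ending at `a ∈ Z`, a start off the block is joined OFF `Z` to a
  terminal that leads to `a`; a start in the block is joined to `a` on `Z`, or on `Z` to a terminal that leads to `a`;
* **`Block.reach_in₂_iff_of_one`**: if `o ~ c₁ off Z` but not `o ~ c₂ off Z`, then for `a ∈ Z`: `o ↔ a ⟺ c₁ ~ a on Z`;
  **`Block.reach_in₂_iff_of_both`**: if `o ~ c₁` and `o ~ c₂` off `Z`: `o ↔ a ⟺ (c₁ ~ a on Z ∨ c₂ ~ a on Z)`;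
  **`Block.not_reach_in₂_of_none`**: if neither terminal is joined to `o` off `Z`, no vertex of `Z` is reached;
* the hypothesis-free converses `Block.reach_in_of_off_on` (an off-`Z` path to a terminal followed by an on-`Z` path is an open path).
So on good configurations the relays of `Z` reached by the observer are exactly those joined on `Z` to the terminals the observer reaches
off `Z` — the "outside type × inside law" bilinear structure of the memo.
[cite: Grimmett1999, §1.3 p. 10] (open paths / clusters); the bookkeeping is [this work].
-/

namespace Summit.CriticalPhenomena.PercolationContinuityZ3.Theorems

namespace Quant

namespace Block

open Finset
open Literature.Probability.Percolation
open Bundle (offZ offZ_subset reachable_of_offZ)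
open scoped Classical

variable {n : ℕ}

/-! ### Conventions (no definitions in this file)
Throughout, "good" is the hypothesis
`hω : ∀ x y, x ≠ y → s(x, y) ∈ ω → x ∈ Z → y ∉ Z → y = c₁ ∨ y = c₂` (every open pair leaving `Z` ends at a terminal), and
"terminal `c` LEADS to `a`" is the proposition
`∃ c', (c' = c₁ ∨ c' = c₂) ∧ (c = c' ∨ c₁ ~ c₂ off Z ∨ c₁ ~ c₂ on Z) ∧ c' ~ a on Z`, written out in full in every statement. -/

section Reach

variable {o c₁ c₂ : Fin n} {Z : Finset (Fin n)}

/-- `Leads` is monotone along on-`Z` connections between terminals: if `c ~ d on Z` for terminals `c, d` and `d` leads to `a`, then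
`c` leads to `a`. [this work] -/
theorem leads_of_onZ_reachable {ω : BondConfig (Fin n)} {c d a : Fin n} (hc : c = c₁ ∨ c = c₂)
    (hcd : (openGraph (onZ Z ω)).Reachable c d) (hd : (∃ c' : Fin n, (c' = c₁ ∨ c' = c₂) ∧ (d = c' ∨ (openGraph (offZ Z ω)).Reachable c₁ c₂ ∨ (openGraph (onZ Z ω)).Reachable c₁ c₂) ∧ (openGraph (onZ Z ω)).Reachable c' a)) :
    (∃ c' : Fin n, (c' = c₁ ∨ c' = c₂) ∧ (c = c' ∨ (openGraph (offZ Z ω)).Reachable c₁ c₂ ∨ (openGraph (onZ Z ω)).Reachable c₁ c₂) ∧ (openGraph (onZ Z ω)).Reachable c' a) := by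
  obtain ⟨c', hc', hdc', hc'a⟩ := hd
  rcases hdc' with rfl | hT
  · -- `c ~ d = c' ~ a on Z`: `c` itself is joined to `a` on `Z`
    exact ⟨c, hc, Or.inl rfl, hcd.trans hc'a⟩
  · exact ⟨c', hc', Or.inr hT, hc'a⟩

/-- `Leads` is monotone along off-`Z` connections between terminals. [this work] -/
theorem leads_of_offZ_reachable {ω : BondConfig (Fin n)} {c d a : Fin n} (hc : c = c₁ ∨ c = c₂) (hd' : d = c₁ ∨ d = c₂)
    (hcd : (openGraph (offZ Z ω)).Reachable c d) (hd : (∃ c' : Fin n, (c' = c₁ ∨ c' = c₂) ∧ (d = c' ∨ (openGraph (offZ Z ω)).Reachable c₁ c₂ ∨ (openGraph (onZ Z ω)).Reachable c₁ c₂) ∧ (openGraph (onZ Z ω)).Reachable c' a)) :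
    (∃ c' : Fin n, (c' = c₁ ∨ c' = c₂) ∧ (c = c' ∨ (openGraph (offZ Z ω)).Reachable c₁ c₂ ∨ (openGraph (onZ Z ω)).Reachable c₁ c₂) ∧ (openGraph (onZ Z ω)).Reachable c' a) := by
  obtain ⟨c', hc', hdc', hc'a⟩ := hd
  by_cases hcd' : c = d
  · subst hcd'; exact ⟨c', hc', hdc', hc'a⟩
  · -- `c ≠ d` are the two terminals, joined off `Z`
    have hT : (openGraph (offZ Z ω)).Reachable c₁ c₂ := by
      rcases hc with rfl | rfl <;> rcases hd' with rfl | rfl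
      · exact absurd rfl hcd'
      · exact hcd
      · exact hcd.symm
      · exact absurd rfl hcd'
    exact ⟨c', hc', Or.inr (Or.inl hT), hc'a⟩

/-- **Walk invariant.**  Along an open walk of a good configuration ending at `a ∈ Z`: a start off the block is joined off `Z` to a
terminal that leads to `a`; a start in the block is joined to `a` on `Z`, or is joined on `Z` to a terminal that leads to `a`.
[this work] -/
theorem inv₂_of_walk {ω : BondConfig (Fin n)} (hω : ∀ x y : Fin n, x ≠ y → s(x, y) ∈ ω → x ∈ Z → y ∉ Z → y = c₁ ∨ y = c₂) {a : Fin n} (ha : a ∈ Z) :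
    ∀ (v : Fin n) (_ : (openGraph ω).Walk v a),
      (v ∉ Z → ∃ c : Fin n, (c = c₁ ∨ c = c₂) ∧ (openGraph (offZ Z ω)).Reachable v c ∧ (∃ c' : Fin n, (c' = c₁ ∨ c' = c₂) ∧ (c = c' ∨ (openGraph (offZ Z ω)).Reachable c₁ c₂ ∨ (openGraph (onZ Z ω)).Reachable c₁ c₂) ∧ (openGraph (onZ Z ω)).Reachable c' a)) ∧
      (v ∈ Z → (openGraph (onZ Z ω)).Reachable v a ∨
        ∃ c : Fin n, (c = c₁ ∨ c = c₂) ∧ (openGraph (onZ Z ω)).Reachable v c ∧ (∃ c' : Fin n, (c' = c₁ ∨ c' = c₂) ∧ (c = c' ∨ (openGraph (offZ Z ω)).Reachable c₁ c₂ ∨ (openGraph (onZ Z ω)).Reachable c₁ c₂) ∧ (openGraph (onZ Z ω)).Reachable c' a)) := by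
  intro v q
  induction q with
  | nil => exact ⟨fun h => absurd ha h, fun _ => Or.inl (SimpleGraph.Reachable.refl _)⟩
  | cons hadj q' ih =>
    rename_i v' x a'
    obtain ⟨h1, h2⟩ := ih ha
    rw [openGraph_adj] at hadj
    obtain ⟨he, hne⟩ := hadj
    constructor
    · intro hv
      by_cases hxZ : x ∈ Z
      · -- the pair enters `Z` from `v'`, so `v'` is a terminal
        have hvc : v' = c₁ ∨ v' = c₂ := hω x v' (Ne.symm hne) (by rw [Sym2.eq_swap]; exact he) hxZ hv
        have hvx : (openGraph (onZ Z ω)).Reachable v' x := (on_adj he hne (Or.inr hxZ)).reachable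
        refine ⟨v', hvc, SimpleGraph.Reachable.refl _, ?_⟩
        rcases h2 hxZ with hxa | ⟨c, hc, hxc, hL⟩
        · exact ⟨v', hvc, Or.inl rfl, hvx.trans hxa⟩
        · exact leads_of_onZ_reachable hvc (hvx.trans hxc) hL
      · obtain ⟨c, hc, hR, hL⟩ := h1 hxZ
        exact ⟨c, hc, (off_adj he hne hv hxZ).reachable.trans hR, hL⟩
    · intro hv
      by_cases hxZ : x ∈ Z
      · have hvx : (openGraph (onZ Z ω)).Reachable v' x := (on_adj he hne (Or.inl hv)).reachable
        rcases h2 hxZ with hxa | ⟨c, hc, hxc, hL⟩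
        · exact Or.inl (hvx.trans hxa)
        · exact Or.inr ⟨c, hc, hvx.trans hxc, hL⟩
      · -- the pair leaves `Z` at `v'`, so `x` is a terminal
        have hxc : x = c₁ ∨ x = c₂ := hω v' x hne he hv hxZ
        obtain ⟨c, hc, hR, hL⟩ := h1 hxZ
        have hvx : (openGraph (onZ Z ω)).Reachable v' x := (on_adj he hne (Or.inl hv)).reachable
        exact Or.inr ⟨x, hxc, hvx, leads_of_offZ_reachable hxc hc hR hL⟩

/-- A vertex of the block reached from outside the block is led to from a terminal joined to `o` off `Z`. [this work] -/
theorem exists_offZ_leads_of_reach {ω : BondConfig (Fin n)} (hω : ∀ x y : Fin n, x ≠ y → s(x, y) ∈ ω → x ∈ Z → y ∉ Z → y = c₁ ∨ y = c₂) (ho : o ∉ Z) {a : Fin n} (ha : a ∈ Z)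
    (h : (openGraph ω).Reachable o a) :
    ∃ c : Fin n, (c = c₁ ∨ c = c₂) ∧ (openGraph (offZ Z ω)).Reachable o c ∧
      (∃ c' : Fin n, (c' = c₁ ∨ c' = c₂) ∧ (c = c' ∨ (openGraph (offZ Z ω)).Reachable c₁ c₂ ∨ (openGraph (onZ Z ω)).Reachable c₁ c₂) ∧ (openGraph (onZ Z ω)).Reachable c' a) := by
  obtain ⟨q⟩ := h
  exact (inv₂_of_walk hω ha o q).1 ho

/-- An off-`Z` path to a terminal followed by an on-`Z` path is an open path (no hypothesis). [this work] -/
theorem reach_in_of_off_on {ω : BondConfig (Fin n)} {c a : Fin n} (h₁ : (openGraph (offZ Z ω)).Reachable o c)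
    (h₂ : (openGraph (onZ Z ω)).Reachable c a) : (openGraph ω).Reachable o a :=
  (reachable_of_offZ h₁).trans (reachable_of_onZ h₂)

/-- **No terminal reached off `Z` ⟹ nothing in the block is reached.** [this work] -/
theorem not_reach_in₂_of_none {ω : BondConfig (Fin n)} (hω : ∀ x y : Fin n, x ≠ y → s(x, y) ∈ ω → x ∈ Z → y ∉ Z → y = c₁ ∨ y = c₂) (ho : o ∉ Z)
    (h₁ : ¬ (openGraph (offZ Z ω)).Reachable o c₁) (h₂ : ¬ (openGraph (offZ Z ω)).Reachable o c₂) {a : Fin n} (ha : a ∈ Z) :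
    ¬ (openGraph ω).Reachable o a := by
  intro h
  obtain ⟨c, hc, hR, -⟩ := exists_offZ_leads_of_reach hω ho ha h
  rcases hc with rfl | rfl
  · exact h₁ hR
  · exact h₂ hR

/-- **Exactly the first terminal reached off `Z` ⟹ the block is seen through it**: if `o ~ c₁ off Z` and not `o ~ c₂ off Z`, then
for `a ∈ Z`: `o ↔ a ⟺ c₁ ~ a on Z`. [this work] -/
theorem reach_in₂_iff_of_one {ω : BondConfig (Fin n)} (hω : ∀ x y : Fin n, x ≠ y → s(x, y) ∈ ω → x ∈ Z → y ∉ Z → y = c₁ ∨ y = c₂) (ho : o ∉ Z)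
    (h₁ : (openGraph (offZ Z ω)).Reachable o c₁) (h₂ : ¬ (openGraph (offZ Z ω)).Reachable o c₂) {a : Fin n} (ha : a ∈ Z) :
    (openGraph ω).Reachable o a ↔ (openGraph (onZ Z ω)).Reachable c₁ a := by
  refine ⟨fun h => ?_, fun h => reach_in_of_off_on h₁ h⟩
  obtain ⟨c, hc, hR, c', hc', hcc', hc'a⟩ := exists_offZ_leads_of_reach hω ho ha h
  -- the terminal reached off `Z` is `c₁`
  have hc1 : c = c₁ := by
    rcases hc with rfl | rfl
    · rfl
    · exact absurd hR h₂
  subst hc1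
  rcases hc' with rfl | rfl
  · exact hc'a
  · -- `c' = c₂` is joined to `a` on `Z`; the terminals are joined around the block, necessarily on `Z`
    rcases hcc' with h12 | hT | hT
    · rw [h12]; exact hc'a
    · exact absurd (hR.trans hT) h₂
    · exact hT.trans hc'a

/-- Symmetric form of `reach_in₂_iff_of_one` for the second terminal. [this work] -/
theorem reach_in₂_iff_of_two {ω : BondConfig (Fin n)} (hω : ∀ x y : Fin n, x ≠ y → s(x, y) ∈ ω → x ∈ Z → y ∉ Z → y = c₁ ∨ y = c₂) (ho : o ∉ Z)
    (h₁ : ¬ (openGraph (offZ Z ω)).Reachable o c₁) (h₂ : (openGraph (offZ Z ω)).Reachable o c₂) {a : Fin n} (ha : a ∈ Z) :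
    (openGraph ω).Reachable o a ↔ (openGraph (onZ Z ω)).Reachable c₂ a :=
  reach_in₂_iff_of_one (fun x y hxy he hx hy => (hω x y hxy he hx hy).symm) ho h₂ h₁ ha

/-- **Both terminals reached off `Z` ⟹ the block is seen through either**: `o ↔ a ⟺ (c₁ ~ a on Z ∨ c₂ ~ a on Z)` for `a ∈ Z`.
[this work] -/
theorem reach_in₂_iff_of_both {ω : BondConfig (Fin n)} (hω : ∀ x y : Fin n, x ≠ y → s(x, y) ∈ ω → x ∈ Z → y ∉ Z → y = c₁ ∨ y = c₂) (ho : o ∉ Z)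
    (h₁ : (openGraph (offZ Z ω)).Reachable o c₁) (h₂ : (openGraph (offZ Z ω)).Reachable o c₂) {a : Fin n} (ha : a ∈ Z) :
    (openGraph ω).Reachable o a ↔ (openGraph (onZ Z ω)).Reachable c₁ a ∨ (openGraph (onZ Z ω)).Reachable c₂ a := by
  refine ⟨fun h => ?_, fun h => h.elim (reach_in_of_off_on h₁) (reach_in_of_off_on h₂)⟩
  obtain ⟨c, -, -, c', hc', -, hc'a⟩ := exists_offZ_leads_of_reach hω ho ha h
  rcases hc' with rfl | rfl
  · exact Or.inl hc'a
  · exact Or.inr hc'a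

/-- **The block relays reached, by outside type** (count form).  On a good configuration, for any relay set `A`:
the number of relays of `A ∩ Z` joined to `o` is `0` if no terminal is joined to `o` off `Z`; the number joined to `c₁` on `Z`
if only `c₁` is; the number joined to `c₂` on `Z` if only `c₂` is; and the number joined to `c₁` or `c₂` on `Z` if both are.
[this work] -/
theorem card_filter_inter_eq₂ {ω : BondConfig (Fin n)} (hω : ∀ x y : Fin n, x ≠ y → s(x, y) ∈ ω → x ∈ Z → y ∉ Z → y = c₁ ∨ y = c₂) (ho : o ∉ Z) (A : Finset (Fin n)) :
    ((A ∩ Z).filter fun a => ω ∈ openConn o a).card =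
      if (openGraph (offZ Z ω)).Reachable o c₁ then
        (if (openGraph (offZ Z ω)).Reachable o c₂ then
          ((A ∩ Z).filter fun a => onZ Z ω ∈ openConn c₁ a ∨ onZ Z ω ∈ openConn c₂ a).card
        else ((A ∩ Z).filter fun a => onZ Z ω ∈ openConn c₁ a).card)
      else
        (if (openGraph (offZ Z ω)).Reachable o c₂ then ((A ∩ Z).filter fun a => onZ Z ω ∈ openConn c₂ a).card else 0) := by
  by_cases h₁ : (openGraph (offZ Z ω)).Reachable o c₁ <;> by_cases h₂ : (openGraph (offZ Z ω)).Reachable o c₂ <;>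
    simp only [h₁, h₂, if_true, if_false]
  · exact congrArg _ (filter_congr fun a ha => reach_in₂_iff_of_both hω ho h₁ h₂ (mem_inter.1 ha).2)
  · exact congrArg _ (filter_congr fun a ha => reach_in₂_iff_of_one hω ho h₁ h₂ (mem_inter.1 ha).2)
  · exact congrArg _ (filter_congr fun a ha => reach_in₂_iff_of_two hω ho h₁ h₂ (mem_inter.1 ha).2)
  · rw [card_eq_zero, filter_eq_empty_iff]
    exact fun a ha => not_reach_in₂_of_none hω ho h₁ h₂ (mem_inter.1 ha).2

/-- The relays of the block that are reached are among all reached relays: `#{a ∈ A ∩ Z : o ↔ a} ≤ #{a ∈ A : o ↔ a}` (no hypothesis).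
[this work] -/
theorem card_filter_inter_le (ω : BondConfig (Fin n)) (A : Finset (Fin n)) :
    ((A ∩ Z).filter fun a => ω ∈ openConn o a).card ≤ (A.filter fun a => ω ∈ openConn o a).card :=
  card_le_card (filter_subset_filter _ inter_subset_left)

end Reach

end Block

end Quant

end Summit.CriticalPhenomena.PercolationContinuityZ3.Theorems
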